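import Literature.NumberTheory.EllipticCurves.SelmerGaloisActionLocal
import HarnessLib

/-!
# `σ_* : H¹(K_v, E[n]) → H¹(K_{σ v}, E[n])` at the finite places of a number field

Companion of `SelmerGaloisActionLocal.lean` (the local action `localConjH1` of `σ ∈ Aut(K/ℚ)` along a
`σ`-semilinear isomorphism of `K`-fields, for `E = W/ℚ`). Here the `K`-fields are the completions
`K_v`, `K_{σ v}` at finite places of a number field `K` and the isomorphism is the Galois transport
of completions `K_v ≃+* K_{σ v}` (tree `galAdicCompletionEquiv`; Cassels–Fröhlich, Ch. VII (Tate)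
§1.1: «`σ` induces by continuity an isomorphism `σ_w : L_w → L_{σ w}`»), with chosen adapted lifts
(`liftAutPlace`, from `exists_isLiftOfAut_liftsCommute`):

* `conjActPlace W σ n h : H¹(K_v, E[n]) →+ H¹(K_w, E[n])` for `h : σ • v = w`, on the local
  cohomology groups `galoisCohomology (ρ.toLocal (Sum.inr v)) 1` of the `LocalGlobalCohomology`
  library (`ρ = (W⁄K).torsionGaloisModule n`), i.e. the groups on which
  `DiscreteGaloisModule.SelmerStructure`s, `galoisCohomology.localization` and local Tate duality
  are formulated;
* `conjActPlace_localization` — `σ_* (loc_v s) = loc_{σ v} (σ_* s)` (`conjAct` on `H¹(K, E[n])`);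
* `conjActPlace_conjActPlace` — for `σ² = 1`: `σ_* ∘ σ_* = id` (`H¹(K_v) → H¹(K_{σv}) → H¹(K_v)`);
* `conjActPlace_mem_kummerSelmerStructure` — `σ_*` carries the local condition of the Kummer Selmer
  structure (`kummerSelmerStructure`, Selmer group `Sel⁽ⁿ⁾(E/K)`) at `v` into the one at `σ v`.

For `K` imaginary quadratic and `σ` complex conjugation these are the inputs «`τ` acts on
`⊕_v H¹(K_v, E[p^m])` permuting `v ↔ v̄`, localisation is `τ`-equivariant, the local conditions are
permuted» of the `±`-eigenspace form of Poitou–Tate duality (Jetchev 2008, §5, Thm. 5.1; Gross 1991,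
§§5, 8). Everything here is PROVED; no named facts; no instance, no notation.

## References

* J. W. S. Cassels, A. Fröhlich (eds.), *Algebraic Number Theory* (1967), Ch. VII (J. Tate), §1.1.
  [CasselsFrohlichANT1967]
* D. Jetchev, *Global divisibility of Heegner points and Tamagawa numbers*, Compos. Math. 144
  (2008), §5, Thm. 5.1. [Jetchev2008]
* B. H. Gross, *Kolyvagin's work on modular elliptic curves*, LMS LNS 153 (1991), §5 (5.1),
  Prop. 8.2. [GrossLMS1991]
* J.-P. Serre, *Local Fields* (1979), VII.§5, Prop. 3; *Galois Cohomology* (1997), II.§1.1.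
  [SerreLocalFields1979] [SerreGaloisCohomology1997]
-/

noncomputable section

open scoped Classical
open WeierstrassCurve Field

universe u

/-! ## At the finite places of a number field: `σ_* : H¹(K_v, E[n]) → H¹(K_{σ v}, E[n])` -/

namespace Literature.NumberTheory.EllipticCurves

section Places

open NumberField IsDedekindDomain Literature.NumberTheory.Automorphic
open Literature.NumberTheory.GaloisRepresentations

variable {K : Type u} [Field K] [NumberField K] (W : WeierstrassCurve ℚ) (σ : K ≃ₐ[ℚ] K) (n : ℤ)

/-- The Galois transports of completions compose: for `σ² = 1`, `σ_{σv} ∘ σ_v = id` on `K_v`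
(cocycle law of the transports, tree `galAdicCompletionMap_galAdicCompletionMap`).
[cite: CasselsFrohlichANT1967, Ch. VII §1.1] -/
theorem galAdicCompletionEquiv_galAdicCompletionEquiv_of_mul_self (hσ : σ * σ = 1)
    {v w : HeightOneSpectrum (𝓞 K)} (h : σ • v = w) (h' : σ • w = v) (x : v.adicCompletion K) :
    galAdicCompletionEquiv (L := K) σ h' (galAdicCompletionEquiv (L := K) σ h x) = x := by
  rw [coe_galAdicCompletionEquiv, coe_galAdicCompletionEquiv,
    galAdicCompletionMap_galAdicCompletionMap,
    galAdicCompletionMap_congr_left K hσ _ (one_smul _ v), galAdicCompletionMap_one]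

/-- A chosen lift of `σ` to `K̄` ADAPTED to the place datum `σ • v = w`: it commutes with the chosen
lift `ringEquivLift` of the transport `K_v ≃+* K_w` and the chosen embeddings `K̄ → K̄_{K_v}`,
`K̄ → K̄_{K_w}` (`exists_isLiftOfAut_liftsCommute`). [cite: SerreGaloisCohomology1997, II.§1.1] -/
def liftAutPlace {v w : HeightOneSpectrum (𝓞 K)} (h : σ • v = w) :
    AlgebraicClosure K ≃+* AlgebraicClosure K :=
  Classical.choose (exists_isLiftOfAut_liftsCommute (E := v.adicCompletion K)
    (E' := w.adicCompletion K) σ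
    (isSemilinearRingEquiv_galAdicCompletionEquiv σ h)
    (isLiftOfRingEquiv_ringEquivLift (galAdicCompletionEquiv (L := K) σ h)))

/-- `liftAutPlace` lifts `σ`. [cite: SerreGaloisCohomology1997, II.§1.1] -/
theorem isLiftOfAut_liftAutPlace {v w : HeightOneSpectrum (𝓞 K)} (h : σ • v = w) :
    IsLiftOfAut σ (liftAutPlace σ h) :=
  (Classical.choose_spec (exists_isLiftOfAut_liftsCommute
    (E := v.adicCompletion K) (E' := w.adicCompletion K) σ
    (isSemilinearRingEquiv_galAdicCompletionEquiv σ h)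
    (isLiftOfRingEquiv_ringEquivLift (galAdicCompletionEquiv (L := K) σ h)))).1

/-- `liftAutPlace` is adapted to the chosen lift of the transport of completions.
[cite: SerreGaloisCohomology1997, II.§1.1] -/
theorem liftsCommute_liftAutPlace {v w : HeightOneSpectrum (𝓞 K)} (h : σ • v = w) :
    LiftsCommute (E := v.adicCompletion K) (E' := w.adicCompletion K) (liftAutPlace σ h)
      (ringEquivLift (galAdicCompletionEquiv (L := K) σ h)) :=
  (Classical.choose_spec (exists_isLiftOfAut_liftsCommute
    (E := v.adicCompletion K) (E' := w.adicCompletion K) σ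
    (isSemilinearRingEquiv_galAdicCompletionEquiv σ h)
    (isLiftOfRingEquiv_ringEquivLift (galAdicCompletionEquiv (L := K) σ h)))).2

/-- **`σ_* : H¹(K_v, E[n]) → H¹(K_{σ v}, E[n])`** at the finite places of a number field `K`, for
`E = W/ℚ` and `σ ∈ Aut(K/ℚ)` with `σ • v = w`: the local action `localConjH1` along the Galois
transport of completions `K_v ≃+* K_w` (tree `galAdicCompletionEquiv`) with its chosen lifts, on
the local cohomology `galoisCohomology (ρ.toLocal (Sum.inr v)) 1` of the `LocalGlobalCohomology`
library (where `SelmerStructure`s and the localisation maps live). Cassels–Fröhlich, Ch. VII §1.1;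
in Jetchev 2008 §5 / Gross 1991 §§5, 8 this is complex conjugation acting on `⊕_λ H¹(K_λ, E[p^m])`,
permuting `λ ↔ λ̄`. [cite: CasselsFrohlichANT1967, Ch. VII §1.1] [cite: Jetchev2008, §5 Thm. 5.1] -/
def conjActPlace {v w : HeightOneSpectrum (𝓞 K)} (h : σ • v = w) :
    galoisCohomology (((W.baseChange K).torsionGaloisModule n).toLocal (Sum.inr v : Place K)) 1 →+
      galoisCohomology (((W.baseChange K).torsionGaloisModule n).toLocal (Sum.inr w : Place K)) 1 :=
  localConjH1 W (isLiftOfAut_liftAutPlace σ h)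
    (isLiftOfRingEquiv_ringEquivLift (galAdicCompletionEquiv (L := K) σ h))
    (liftsCommute_liftAutPlace σ h) n

/-- **`σ_*` intertwines the localisation maps**: `σ_* (loc_v s) = loc_{σ v} (σ_* s)` for
`s ∈ H¹(K, E[n])`, `loc_v = galoisCohomology.localization`, `σ_*` on `H¹(K, E[n])` being `conjAct`
(`localConjH1_res`). Jetchev 2008 §5 (Thm. 5.1 on `±`-eigenspaces uses exactly this
`τ`-equivariance of `H¹(K, ·) → ⊕_v H¹(K_v, ·)`). [cite: Jetchev2008, §5 Thm. 5.1]
[cite: GrossLMS1991, Prop. 8.2] -/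
theorem conjActPlace_localization {v w : HeightOneSpectrum (𝓞 K)} (h : σ • v = w)
    (s : galH1Torsion (W.baseChange K) n) :
    conjActPlace W σ n h (galoisCohomology.localization ((W.baseChange K).torsionGaloisModule n)
        (Sum.inr v : Place K) 1 s) =
      galoisCohomology.localization ((W.baseChange K).torsionGaloisModule n)
        (Sum.inr w : Place K) 1 (conjAct W σ n s) :=
  localConjH1_res W _ _ _ n s

/-- **Round trip at the places**: for `σ² = 1` (complex conjugation of an imaginary quadratic
field), `σ_* ∘ σ_* = id : H¹(K_v, E[n]) → H¹(K_{σv}, E[n]) → H¹(K_v, E[n])`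
(`localConjH1_localConjH1` with `σ_{σ v} ∘ σ_v = id` on `K_v`). [cite: CasselsFrohlichANT1967, Ch. VII §1.1]
[cite: SerreLocalFields1979, VII.§5 Prop. 3] -/
theorem conjActPlace_conjActPlace (hσ : σ * σ = 1) {v w : HeightOneSpectrum (𝓞 K)}
    (h : σ • v = w) (h' : σ • w = v)
    (c : galoisCohomology (((W.baseChange K).torsionGaloisModule n).toLocal
      (Sum.inr v : Place K)) 1) :
    conjActPlace W σ n h' (conjActPlace W σ n h c) = c :=
  localConjH1_localConjH1 W _ _ _ _ _ _
    (galAdicCompletionEquiv_galAdicCompletionEquiv_of_mul_self σ hσ h h') n c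

/-- **`σ_*` carries the Kummer local condition at `v` into the one at `σ v`**: the local conditions
of the Kummer Selmer structure (`kummerSelmerStructure`, whose Selmer group is `Sel⁽ⁿ⁾(E/K)`) are
permuted by `σ_*` along `v ↦ σ v` (`localConjH1_mem_kummerLocalConditionAt`) — the local form of the
`Gal(K/ℚ)`-stability of `Sel⁽ⁿ⁾(E/K)` (`conjAct_mem_selmerGroup`; Gross 1991 §5).
[cite: GrossLMS1991, §5 (5.1)] [cite: SilvermanAEC2009, X.§4] -/
theorem conjActPlace_mem_kummerSelmerStructure {v w : HeightOneSpectrum (𝓞 K)} (h : σ • v = w)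
    {c : galoisCohomology (((W.baseChange K).torsionGaloisModule n).toLocal
      (Sum.inr v : Place K)) 1}
    (hc : c ∈ (W.baseChange K).kummerSelmerStructure n (Sum.inr v : Place K)) :
    conjActPlace W σ n h c ∈ (W.baseChange K).kummerSelmerStructure n (Sum.inr w : Place K) := by
  haveI : CharZero (v.adicCompletion K) :=
    charZero_of_injective_algebraMap (algebraMap K _).injective
  haveI : CharZero (w.adicCompletion K) :=
    charZero_of_injective_algebraMap (algebraMap K _).injective
  exact localConjH1_mem_kummerLocalConditionAt (E := v.adicCompletion K) (E' := w.adicCompletion K)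
    W _ _ _ n hc

end Places

end Literature.NumberTheory.EllipticCurves

end
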